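import Literature.Barriers.AnomalousDissipation.CodimensionOneRigidityAlberti
import HarnessLib

/-!
# A finite family of Alberti kernels serving all trace-free directions

Support file for the discharge of the named fact
`Literature.Barriers.AnomalousDissipation.DeRosaInversi2024_thm12` (`CodimensionOneRigidity.lean`):
the compactness step by which the pointwise kernel optimisation of Alberti's lemma
(`exists_isMollifier_integral_abs_fderiv_apply_le`) is made uniform (De Rosa–Inversi 2024,
Prop. 2.8: there a countable dense family of kernels and the Radon–Nikodym theorem; here a finite
family and a measurable selection, which is what the measure-free assembly of
`CodimensionOneRigidityProofs` needs).

`exists_finite_kernel_family`: for every `η > 0` there are finitely many mollifiers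
`ρ₁, …, ρₙ` and a measurable selection `sel : (ℝ^d →L ℝ^d) → Option (Fin n)` such that every
non-zero trace-free `A` is selected (`sel A = some i`), and whenever `sel A = some i`,
`∫ |Dρᵢ(z)(Az)| dz ≤ η ‖A‖`. Proof: the set of trace-free `A` with `‖A‖ = 1` is compact; each
of its points has an Alberti kernel with energy `< η/2`, which stays `< η` on a ball by the
Lipschitz bound `dist_integral_abs_fderiv_apply_le`; extract a finite subcover and select the
least index whose ball contains `A/‖A‖`; conclude by homogeneity. Everything is proved;
theorems only.

## References

* L. De Rosa, M. Inversi, Comm. Math. Phys. 405 (2024), Lemma 2.7, Prop. 2.8 (arXiv:2307.09189).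
-/

noncomputable section

open MeasureTheory TopologicalSpace Set Function Filter Topology Metric
open scoped ENNReal NNReal

namespace Literature.Barriers.AnomalousDissipation

namespace CodimensionOneRigidity

open Literature.Analysis Literature.Analysis.FunctionSpaces Literature.Analysis.FluidPDE

variable {d : Type} [Fintype d] [DecidableEq d]

omit [DecidableEq d] in
/-- Homogeneity of the anisotropic energy in the matrix: `∫ |Dρ(z)((cA)z)| = |c| ∫ |Dρ(z)(Az)|`. [folklore] -/
theorem integral_abs_fderiv_apply_smul (ρ : EuclideanSpace ℝ d → ℝ) (c : ℝ)
    (A : EuclideanSpace ℝ d →L[ℝ] EuclideanSpace ℝ d) :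
    ∫ z, |fderiv ℝ ρ z ((c • A) z)| = |c| * ∫ z, |fderiv ℝ ρ z (A z)| := by
  rw [← integral_const_mul]
  refine integral_congr_ae (ae_of_all _ fun z => ?_)
  dsimp only
  rw [show (c • A) z = c • A z from rfl, map_smul, smul_eq_mul, abs_mul]

omit [DecidableEq d] in
/-- Normalisation: `‖A‖⁻¹ • A` has norm `1` for `A ≠ 0`. [folklore] -/
theorem norm_inv_norm_smul {A : EuclideanSpace ℝ d →L[ℝ] EuclideanSpace ℝ d} (hA : A ≠ 0) :
    ‖‖A‖⁻¹ • A‖ = 1 := by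
  rw [norm_smul, norm_inv, norm_norm, inv_mul_cancel₀ (norm_ne_zero_iff.2 hA)]

omit [DecidableEq d] in
/-- The normalisation map `A ↦ ‖A‖⁻¹ • A` is measurable. [folklore] -/
theorem measurable_inv_norm_smul :
    Measurable fun A : EuclideanSpace ℝ d →L[ℝ] EuclideanSpace ℝ d => ‖A‖⁻¹ • A :=
  (measurable_norm.inv).smul measurable_id

/-- **A finite family of Alberti kernels** (De Rosa–Inversi 2024, Lemma 2.7 made uniform over the
compact set of trace-free directions, the role of Prop. 2.8): for `η > 0` there are mollifiers
`ρ₁, …, ρₙ` and a measurable selection `sel` with: every non-zero trace-free `A` is selected, and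
`sel A = some i ⟹ ∫ |Dρᵢ(z)(Az)| dz ≤ η ‖A‖`. [cite: DeRosaInversi2024, Lemma 2.7 and Prop. 2.8] -/
theorem exists_finite_kernel_family {η : ℝ} (hη : 0 < η) :
    ∃ (n : ℕ) (ρs : Fin n → EuclideanSpace ℝ d → ℝ)
      (sel : (EuclideanSpace ℝ d →L[ℝ] EuclideanSpace ℝ d) → Option (Fin n)),
      (∀ i, IsMollifier (ρs i)) ∧
      (∀ i, MeasurableSet {A : EuclideanSpace ℝ d →L[ℝ] EuclideanSpace ℝ d | sel A = some i}) ∧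
      (∀ A : EuclideanSpace ℝ d →L[ℝ] EuclideanSpace ℝ d,
        LinearMap.trace ℝ (EuclideanSpace ℝ d) (A : EuclideanSpace ℝ d →ₗ[ℝ] EuclideanSpace ℝ d) = 0 →
          A ≠ 0 → ∃ i, sel A = some i) ∧
      ∀ (A : EuclideanSpace ℝ d →L[ℝ] EuclideanSpace ℝ d) (i : Fin n), sel A = some i →
        ∫ z, |fderiv ℝ (ρs i) z (A z)| ≤ η * ‖A‖ := by
  classical
  -- the trace as a continuous linear functional on `ℝ^d →L ℝ^d`
  set τ : (EuclideanSpace ℝ d →L[ℝ] EuclideanSpace ℝ d) →ₗ[ℝ] ℝ :=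
    (LinearMap.trace ℝ (EuclideanSpace ℝ d)).comp (ContinuousLinearMap.coeLM ℝ) with hτdef
  have hτ : ∀ A : EuclideanSpace ℝ d →L[ℝ] EuclideanSpace ℝ d,
      τ A = LinearMap.trace ℝ (EuclideanSpace ℝ d) (A : EuclideanSpace ℝ d →ₗ[ℝ] EuclideanSpace ℝ d) :=
    fun A => rfl
  have hτc : Continuous τ := LinearMap.continuous_of_finiteDimensional τ
  -- the compact set of trace-free directions
  set S : Set (EuclideanSpace ℝ d →L[ℝ] EuclideanSpace ℝ d) := {A | τ A = 0} ∩ sphere 0 1 with hS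
  have hSc : IsCompact S := (isCompact_sphere _ _).inter_left (isClosed_eq hτc continuous_const)
  -- an Alberti kernel at every trace-free point
  obtain ⟨ρ₀, hρ₀⟩ := exists_isMollifier (d := d)
  have hker : ∀ A : EuclideanSpace ℝ d →L[ℝ] EuclideanSpace ℝ d, ∃ ρ : EuclideanSpace ℝ d → ℝ,
      IsMollifier ρ ∧ (τ A = 0 → (∫ z, |fderiv ℝ ρ z (A z)|) ≤ η / 2) := by
    intro A
    by_cases hA : τ A = 0
    · obtain ⟨ρ, hρ, hρb⟩ := exists_isMollifier_integral_abs_fderiv_apply_le A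
        ((hτ A).symm.trans hA) (half_pos hη)
      exact ⟨ρ, hρ, fun _ => hρb⟩
    · exact ⟨ρ₀, hρ₀, fun h => absurd h hA⟩
  choose ρA hρA hρAb using hker
  -- the Lipschitz constants and the radii
  set L : (EuclideanSpace ℝ d →L[ℝ] EuclideanSpace ℝ d) → ℝ := fun A =>
    ∫ z, ‖fderiv ℝ (ρA A) z‖ * ‖z‖ with hL
  have hL0 : ∀ A, 0 ≤ L A := fun A => integral_nonneg fun z => by positivity
  set r : (EuclideanSpace ℝ d →L[ℝ] EuclideanSpace ℝ d) → ℝ := fun A => η / (2 * (L A + 1)) with hr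
  have hr0 : ∀ A, 0 < r A := fun A => by
    simp only [hr]
    have := hL0 A
    positivity
  -- on the ball `U A = ball A (r A)` the energy of `ρA A` stays below `η`
  have hball : ∀ A ∈ S, ∀ B ∈ ball A (r A), ∫ z, |fderiv ℝ (ρA A) z (B z)| < η := by
    intro A hA B hB
    have hρ1 : ContDiff ℝ 1 (ρA A) := (hρA A).1.of_le (by simp)
    have hd := dist_integral_abs_fderiv_apply_le hρ1 (hρA A).2.1 B A
    rw [Real.dist_eq] at hd
    have hA0 : τ A = 0 := hA.1
    have h1 := hρAb A hA0
    have h2 : ‖B - A‖ < r A := by rwa [mem_ball, dist_eq_norm] at hB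
    have h3 : L A * ‖B - A‖ ≤ L A * r A := mul_le_mul_of_nonneg_left h2.le (hL0 A)
    have h4 : L A * r A < η / 2 := by
      simp only [hr]
      rw [mul_div_assoc', div_lt_div_iff₀ (by have := hL0 A; positivity) two_pos]
      nlinarith [hL0 A]
    have h5 := (abs_le.1 (hd.trans h3)).2
    linarith
  -- finite subcover
  obtain ⟨t, htS, hcover⟩ := hSc.elim_nhds_subcover (fun A => ball A (r A))
    fun A _ => ball_mem_nhds A (hr0 A)
  set n : ℕ := t.card with hn
  set Af : Fin n → EuclideanSpace ℝ d →L[ℝ] EuclideanSpace ℝ d := fun i => (t.equivFin.symm i : ↥t)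
    with hAf
  have hAft : ∀ i, Af i ∈ t := fun i => (t.equivFin.symm i).2
  -- the selection: the least index whose ball contains the normalised matrix
  set p : Fin n → (EuclideanSpace ℝ d →L[ℝ] EuclideanSpace ℝ d) → Prop := fun i A =>
    ‖A‖⁻¹ • A ∈ ball (Af i) (r (Af i)) with hp
  set good : (EuclideanSpace ℝ d →L[ℝ] EuclideanSpace ℝ d) → Finset (Fin n) := fun A =>
    Finset.univ.filter fun i => p i A with hgood
  set sel : (EuclideanSpace ℝ d →L[ℝ] EuclideanSpace ℝ d) → Option (Fin n) := fun A =>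
    if h : (good A).Nonempty then some ((good A).min' h) else none with hsel
  have hsel_some : ∀ A i, sel A = some i ↔ p i A ∧ ∀ j, p j A → i ≤ j := by
    intro A i
    simp only [hsel]
    constructor
    · intro h
      split_ifs at h with hne
      · have hi : (good A).min' hne = i := Option.some_injective _ h
        refine ⟨?_, fun j hj => ?_⟩
        · have := Finset.min'_mem (good A) hne
          rw [hi] at this
          simpa [hgood] using this
        · rw [← hi]
          exact Finset.min'_le _ _ (by simpa [hgood] using hj)
    · rintro ⟨hi, hmin⟩
      have hmem : i ∈ good A := by simpa [hgood] using hi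
      have hne : (good A).Nonempty := ⟨i, hmem⟩
      rw [dif_pos hne]
      congr 1
      refine le_antisymm (Finset.min'_le _ _ hmem) ?_
      exact hmin _ (by simpa [hgood] using Finset.min'_mem (good A) hne)
  have hpm : ∀ i, MeasurableSet {A : EuclideanSpace ℝ d →L[ℝ] EuclideanSpace ℝ d | p i A} := fun i =>
    measurable_inv_norm_smul (isOpen_ball.measurableSet)
  refine ⟨n, fun i => ρA (Af i), sel, fun i => hρA _, fun i => ?_, fun A hA hA0 => ?_,
    fun A i hi => ?_⟩
  · -- measurability of the fibres of `sel`
    have hset : {A : EuclideanSpace ℝ d →L[ℝ] EuclideanSpace ℝ d | sel A = some i} =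
        {A | p i A} ∩ ⋂ j ∈ (Finset.univ.filter fun j : Fin n => j < i),
          {A : EuclideanSpace ℝ d →L[ℝ] EuclideanSpace ℝ d | p j A}ᶜ := by
      ext A
      simp only [mem_setOf_eq, hsel_some, mem_inter_iff, mem_iInter, mem_compl_iff,
        Finset.mem_filter, Finset.mem_univ, true_and]
      constructor
      · rintro ⟨hi, hmin⟩
        exact ⟨hi, fun j hj hpj => absurd (hmin j hpj) (not_le.2 hj)⟩
      · rintro ⟨hi, hmin⟩
        exact ⟨hi, fun j hpj => not_lt.1 fun hj => hmin j hj hpj⟩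
    rw [hset]
    exact (hpm i).inter (Finset.measurableSet_biInter _ fun j _ => (hpm j).compl)
  · -- every non-zero trace-free matrix is selected
    set B : EuclideanSpace ℝ d →L[ℝ] EuclideanSpace ℝ d := ‖A‖⁻¹ • A with hB
    have hBS : B ∈ S := by
      refine ⟨?_, ?_⟩
      · show τ B = 0
        rw [hB, map_smul, smul_eq_mul, hτ A, hA, mul_zero]
      · rw [mem_sphere_zero_iff_norm, hB, norm_inv_norm_smul hA0]
    obtain ⟨x, hx, hxB⟩ : ∃ x ∈ t, B ∈ ball x (r x) := by
      have := hcover hBS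
      simpa only [mem_iUnion, exists_prop] using this
    set i : Fin n := t.equivFin ⟨x, hx⟩ with hi
    have hAfi : Af i = x := by simp [hAf, hi]
    have hpi : p i A := by
      show ‖A‖⁻¹ • A ∈ ball (Af i) (r (Af i))
      rw [hAfi]
      exact hxB
    have hne : (good A).Nonempty := ⟨i, by simpa [hgood] using hpi⟩
    exact ⟨(good A).min' hne, by simp only [hsel, dif_pos hne]⟩
  · -- the bound, by homogeneity
    have hpi : p i A := ((hsel_some A i).1 hi).1
    by_cases hA0 : A = 0
    · subst hA0
      simp
    · have hlt := hball (Af i) (htS _ (hAft i)) _ hpi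
      have hdecomp : A = ‖A‖ • (‖A‖⁻¹ • A) := by
        rw [smul_smul, mul_inv_cancel₀ (norm_ne_zero_iff.2 hA0), one_smul]
      rw [hdecomp, integral_abs_fderiv_apply_smul, abs_of_nonneg (norm_nonneg _), norm_smul,
        norm_norm, norm_inv_norm_smul hA0, mul_one, mul_comm]
      exact mul_le_mul_of_nonneg_right hlt.le (norm_nonneg _)

end CodimensionOneRigidity

end Literature.Barriers.AnomalousDissipation

end
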